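import Literature.NumberTheory.Automorphic.ParabolicGLBigCell
import Mathlib.LinearAlgebra.Matrix.Transvection
import Mathlib.Data.Matrix.Basis
import HarnessLib

/-!
# The subgroup `L° = {|det_a| = 1}` of the standard Levi of `GL_n(F)`

Group theory of the open normal subgroup
`L° = {m ∈ Π_a GL(B_a, F) : |det m_a| = 1 for all a}` of the standard Levi
`L = Π_a GL(B_a, F)` (`B_a = {i // c i = a}`, `c : Fin n → Fin r`) over a non-archimedean local
field — the group on which cuspidal representations become *compact* (Bernstein–Zelevinsky 1976,
§3.3 and §2.40: `G° = {g : |det g| = 1}`; Bushnell–Henniart 2006, §10: `°G`):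

* `Literature.NumberTheory.Automorphic.leviDetOne F c` (definition), `mem_leviDetOne_iff`,
  normality, openness (`isOpen_leviDetOne`);
* `leviIntegral F c ≤ leviDetOne F c` and the Levi congruence levels
  `(congruenceGL n γ).comap (blockDiagonalGL F c) ≤ leviIntegral F c` (`comap_congruenceGL_le_leviIntegral`);
* **the centre of `L°` is compact** (`isCompact_center_leviDetOne`): a central element commutes with the
  transvections of each block, hence is a block scalar `s_a` (Mathlib
  `Matrix.mem_range_scalar_of_commute_single`) with `|s_a| = 1`, so the centre lies in the compact
  `Π_a GL(B_a, 𝒪)`.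

Theorems and one definition (`leviDetOne`); no named facts.

## References

* I. N. Bernstein, A. V. Zelevinsky, *Representations of the group `GL(n, F)` where `F` is a
  non-archimedean local field*, Russian Math. Surveys 31:3 (1976), §2.40, §3.3.
* C. J. Bushnell, G. Henniart, *The local Langlands conjecture for `GL(2)`* (2006), §10.
-/

noncomputable section

open scoped MatrixGroups
open Matrix ValuativeRel

namespace Literature.NumberTheory.Automorphic

section Def

variable (F : Type*) [Field F] [ValuativeRel F] {n r : ℕ} (c : Fin n → Fin r)

/-- The subgroup **`L° = {m : |det m_a| = 1 for all blocks a}`** of the standard Levi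
`Π_a GL(B_a, F)`. (Bernstein–Zelevinsky 1976, §3.3 `G°`; Bushnell–Henniart 2006, §10 `°G`.)
[cite: BernsteinZelevinsky1976, §3.3] -/
def leviDetOne : Subgroup (Π a, GL {i // c i = a} F) where
  carrier := {g | ∀ a, valuation F ((Matrix.GeneralLinearGroup.det (g a) : Fˣ) : F) = 1}
  one_mem' a := by simp
  mul_mem' {g h} hg hh a := by
    rw [Pi.mul_apply, map_mul, Units.val_mul, map_mul, hg a, hh a, one_mul]
  inv_mem' {g} hg a := by
    rw [Pi.inv_apply, map_inv, Units.val_inv_eq_inv_val, map_inv₀, hg a, inv_one]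

variable {F c}

/-- Membership in `L°`. [folklore] -/
theorem mem_leviDetOne_iff {g : Π a, GL {i // c i = a} F} :
    g ∈ leviDetOne F c ↔ ∀ a, valuation F ((Matrix.GeneralLinearGroup.det (g a) : Fˣ) : F) = 1 := Iff.rfl

/-- `L°` is normal in the Levi (`det (h g h⁻¹) = det g`). [folklore] -/
instance normal_leviDetOne : (leviDetOne F c).Normal := ⟨fun g hg h a => by
  rw [Pi.mul_apply, Pi.mul_apply, Pi.inv_apply, map_mul, map_mul, map_inv, mul_inv_cancel_comm]
  exact hg a⟩

/-- `Π_a GL(B_a, 𝒪) ≤ L°`. [folklore] -/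
theorem leviIntegral_le_leviDetOne : leviIntegral F c ≤ leviDetOne F c := by
  intro k hk a
  rw [mem_leviIntegral_iff] at hk
  have h := valuation_det_eq_one_of_mem_glInt (hk a)
  rw [reindexGL_symm, coe_reindexGL, Matrix.det_reindex_self] at h
  rwa [Matrix.GeneralLinearGroup.val_det_apply]

/-- The Levi congruence levels `K^L_γ = {k : diag(k) ∈ K_γ}` lie in `Π_a GL(B_a, 𝒪)`: the blocks of
a block diagonal matrix in `GL_n(𝒪)` are integral with integral inverse. [folklore] -/
theorem comap_congruenceGL_le_leviIntegral (γ : ValueGroupWithZero F) :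
    (congruenceGL n γ).comap (blockDiagonalGL F c) ≤ leviIntegral F c := by
  intro k hk
  rw [Subgroup.mem_comap] at hk
  have hint := congruenceGL_le_glInt γ hk
  rw [mem_glInt_iff] at hint
  -- entries of the blocks are entries of the block diagonal matrix
  have hblock : ∀ (k' : Π a, GL {i // c i = a} F) (a : Fin r) (i j : {i // c i = a}),
      ((k' a : GL {i // c i = a} F) : Matrix _ _ F) i j =
        ((blockDiagonalGL F c k' : GL (Fin n) F) : Matrix (Fin n) (Fin n) F) i.1 j.1 := by
    intro k' a i j
    obtain ⟨i, hi⟩ := i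
    obtain ⟨j, hj⟩ := j
    subst hi
    rw [blockDiagonalGL_apply_coe]
    have : (⟨c j, ⟨j, rfl⟩⟩ : Σ a, {l // c l = a}) = ⟨c i, ⟨j, hj⟩⟩ := Sigma.subtype_ext hj rfl
    rw [this, Matrix.blockDiagonal'_apply_eq]
  rw [mem_leviIntegral_iff]
  intro a
  rw [mem_glInt_iff]
  constructor
  · intro i j
    have := hint.1 ((blockEnum c a) i).1 ((blockEnum c a) j).1
    rw [← hblock] at this
    simpa [reindexGL_symm, Matrix.reindex_apply, Matrix.submatrix_apply] using this
  · intro i j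
    have := hint.2 ((blockEnum c a) i).1 ((blockEnum c a) j).1
    rw [← map_inv, ← hblock] at this
    rw [← map_inv, reindexGL_symm, coe_reindexGL, Matrix.reindex_apply, Matrix.submatrix_apply]
    simpa [Equiv.symm_symm, Pi.inv_apply] using this

/-- The Levi congruence levels lie in `L°`. [folklore] -/
theorem comap_congruenceGL_le_leviDetOne (γ : ValueGroupWithZero F) :
    (congruenceGL n γ).comap (blockDiagonalGL F c) ≤ leviDetOne F c :=
  (comap_congruenceGL_le_leviIntegral γ).trans leviIntegral_le_leviDetOne

variable [TopologicalSpace F] [IsNonarchimedeanLocalField F]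

/-- `L°` is open: `|det|` is locally constant. [folklore] -/
theorem isOpen_leviDetOne : IsOpen (leviDetOne F c : Set (Π a, GL {i // c i = a} F)) := by
  haveI : IsTopologicalRing F := inferInstance
  have : (leviDetOne F c : Set (Π a, GL {i // c i = a} F)) =
      ⋂ a, (fun g : Π a, GL {i // c i = a} F => (Units.val (g a)).det) ⁻¹' {x : F | valuation F x = 1} := by
    ext g
    simp only [SetLike.mem_coe, mem_leviDetOne_iff, Set.mem_iInter, Set.mem_preimage, Set.mem_setOf_eq,
      Matrix.GeneralLinearGroup.val_det_apply]
  rw [this]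
  refine isOpen_iInter_of_finite fun a => ?_
  refine (DeltaCharBorel.isOpen_setOf_valuation_eq one_ne_zero).preimage ?_
  exact ((Units.continuous_val.comp (continuous_apply a)).matrix_det)

/-! ### The centre of `L°` is compact -/

omit [TopologicalSpace F] [IsNonarchimedeanLocalField F] in
/-- A block of a central element of `L°` commutes with the elementary matrices of that block, hence
is a scalar matrix. [folklore] -/
theorem exists_eq_scalar_of_mem_center {z : leviDetOne F c} (hz : z ∈ Subgroup.center (leviDetOne F c))
    (a : Fin r) : ∃ s : F, (Units.val ((z : Π a, GL {i // c i = a} F) a)) = Matrix.scalar {i // c i = a} s := by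
  have hc : Pairwise fun i j => Commute (Matrix.single i j (1 : F)) (Units.val ((z : Π a, GL {i // c i = a} F) a)) := by
    intro i j hij
    -- the transvection `1 + E_{ij}` of block `a`, an element of `L°`
    set T : Matrix {i // c i = a} {i // c i = a} F := Matrix.transvection i j 1 with hT
    have hTdet : T.det ≠ 0 := by rw [hT, Matrix.det_transvection_of_ne _ _ hij]; exact one_ne_zero
    set Tgl : GL {i // c i = a} F := Matrix.GeneralLinearGroup.mkOfDetNeZero T hTdet with hTgl
    set t : Π a, GL {i // c i = a} F := Pi.mulSingle a Tgl with ht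
    have htmem : t ∈ leviDetOne F c := by
      intro b
      by_cases hb : b = a
      · subst hb
        rw [ht, Pi.mulSingle_eq_same, Matrix.GeneralLinearGroup.val_det_apply, hTgl]
        change valuation F (Matrix.det T) = 1
        rw [hT, Matrix.det_transvection_of_ne _ _ hij, map_one]
      · rw [ht, Pi.mulSingle_eq_of_ne hb, map_one, Units.val_one, map_one]
    have hcomm := Subgroup.mem_center_iff.1 hz ⟨t, htmem⟩
    have hcomm' : t * (z : Π a, GL {i // c i = a} F) = (z : Π a, GL {i // c i = a} F) * t :=
      congrArg Subtype.val hcomm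
    have hblock := congrFun hcomm' a
    rw [Pi.mul_apply, Pi.mul_apply, ht, Pi.mulSingle_eq_same] at hblock
    have hmat := congrArg (fun g : GL {i // c i = a} F => Units.val g) hblock
    simp only [Units.val_mul, hTgl] at hmat
    change T * _ = _ * T at hmat
    rw [hT, Matrix.transvection, add_mul, mul_add, one_mul, mul_one] at hmat
    exact add_left_cancel hmat
  obtain ⟨s, hs⟩ := Matrix.mem_range_scalar_of_commute_single hc
  exact ⟨s, hs.symm⟩

omit [TopologicalSpace F] [IsNonarchimedeanLocalField F] in
/-- A scalar `s` with `|s|^d = 1`, `d ≠ 0`, has `|s| = 1`. [folklore] -/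
theorem valuation_eq_one_of_pow_eq_one {s : F} {d : ℕ} (hd : d ≠ 0) (h : valuation F s ^ d = 1) :
    valuation F s = 1 := by
  rcases lt_trichotomy (valuation F s) 1 with hlt | heq | hgt
  · exact absurd h (pow_lt_one₀ zero_le hlt hd).ne
  · exact heq
  · exact absurd h (one_lt_pow₀ hgt hd).ne'

omit [TopologicalSpace F] [IsNonarchimedeanLocalField F] in
/-- Entries of a reindexed scalar matrix with `|s| ≤ 1` are integral. [folklore] -/
theorem valuation_reindex_scalar_le_one {m m' : Type*} [Fintype m] [DecidableEq m] [Fintype m'] [DecidableEq m']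
    (e : m ≃ m') {s : F} (hs : valuation F s ≤ 1) (i j : m') :
    valuation F (Matrix.reindex e e (Matrix.scalar m s) i j) ≤ 1 := by
  rw [Matrix.reindex_apply, Matrix.submatrix_apply, Matrix.scalar_apply, Matrix.diagonal_apply]
  split_ifs
  · exact hs
  · rw [map_zero]; exact zero_le

omit [TopologicalSpace F] [IsNonarchimedeanLocalField F] in
/-- For a central `z ∈ L°` and a block `a`: the block is a scalar `s` with `|s| ≤ 1`. [folklore] -/
theorem exists_eq_scalar_valuation_le_of_mem_center {z : leviDetOne F c}
    (hz : z ∈ Subgroup.center (leviDetOne F c)) (a : Fin r) :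
    ∃ s : F, valuation F s ≤ 1 ∧ Units.val ((z : Π a, GL {i // c i = a} F) a) = Matrix.scalar {i // c i = a} s := by
  obtain ⟨s, hs⟩ := exists_eq_scalar_of_mem_center hz a
  by_cases hcard : Fintype.card {i // c i = a} = 0
  · -- empty block: the scalar is irrelevant, take `0`
    haveI : IsEmpty {i // c i = a} := Fintype.card_eq_zero_iff.1 hcard
    exact ⟨0, by rw [map_zero]; exact zero_le, Subsingleton.elim _ _⟩
  · refine ⟨s, le_of_eq ?_, hs⟩
    have hdet := z.2 a
    rw [Matrix.GeneralLinearGroup.val_det_apply, hs, Matrix.scalar_apply, Matrix.det_diagonal, Finset.prod_const,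
      Finset.card_univ, map_pow] at hdet
    exact valuation_eq_one_of_pow_eq_one hcard hdet

omit [TopologicalSpace F] [IsNonarchimedeanLocalField F] in
/-- **Central elements of `L°` are integral**: the centre of `L°` lies in `Π_a GL(B_a, 𝒪)` (each
block of `z` and of `z⁻¹` is a scalar of valuation `≤ 1`). [folklore] -/
theorem coe_mem_leviIntegral_of_mem_center {z : leviDetOne F c} (hz : z ∈ Subgroup.center (leviDetOne F c)) :
    (z : Π a, GL {i // c i = a} F) ∈ leviIntegral F c := by
  rw [mem_leviIntegral_iff]
  intro a
  obtain ⟨s, hs1, hs⟩ := exists_eq_scalar_valuation_le_of_mem_center hz a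
  obtain ⟨s', hs1', hs'⟩ := exists_eq_scalar_valuation_le_of_mem_center (Subgroup.inv_mem _ hz) a
  rw [mem_glInt_iff]
  constructor
  · intro i j
    rw [Valuation.mem_integer_iff, reindexGL_symm, coe_reindexGL, hs]
    exact valuation_reindex_scalar_le_one _ hs1 i j
  · intro i j
    rw [Valuation.mem_integer_iff, ← map_inv, reindexGL_symm, coe_reindexGL,
      show ((z : Π a, GL {i // c i = a} F) a)⁻¹ = ((z⁻¹ : leviDetOne F c) : Π a, GL {i // c i = a} F) a from rfl, hs']
    exact valuation_reindex_scalar_le_one _ hs1' i j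

/-- The centre of a Hausdorff topological group is closed. [folklore] -/
theorem isClosed_center {G : Type*} [Group G] [TopologicalSpace G] [IsTopologicalGroup G] [T2Space G] :
    IsClosed (Subgroup.center G : Set G) := by
  have : (Subgroup.center G : Set G) = ⋂ g : G, {z | g * z = z * g} := by
    ext z
    simp only [SetLike.mem_coe, Subgroup.mem_center_iff, Set.mem_iInter, Set.mem_setOf_eq]
  rw [this]
  exact isClosed_iInter fun g => isClosed_eq (continuous_const.mul continuous_id) (continuous_id.mul continuous_const)

/-- **The centre of `L°` is compact**: it is closed and contained in the compact subgroup
`Π_a GL(B_a, 𝒪) ∩ L°` of `L°`. (Bernstein–Zelevinsky 1976, §3.3: on `G°` cuspidal representations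
are compact.) [cite: BernsteinZelevinsky1976, §3.3] -/
theorem isCompact_center_leviDetOne :
    IsCompact (Subgroup.center (leviDetOne F c) : Set (leviDetOne F c)) := by
  haveI : IsTopologicalRing F := inferInstance
  haveI := (GaloisRepresentations.IsNonarchimedeanLocalField.isLocalField F).toT2Space
  have hsub : (Subgroup.center (leviDetOne F c) : Set (leviDetOne F c)) ⊆
      ((leviIntegral F c).subgroupOf (leviDetOne F c) : Subgroup (leviDetOne F c)) := fun z hz =>
    Subgroup.mem_subgroupOf.2 (coe_mem_leviIntegral_of_mem_center hz)
  have hK : IsCompact (((leviIntegral F c).subgroupOf (leviDetOne F c) : Subgroup (leviDetOne F c)) :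
      Set (leviDetOne F c)) := by
    rw [Topology.IsEmbedding.subtypeVal.isCompact_iff]
    convert isCompact_leviIntegral F c
    ext x
    constructor
    · rintro ⟨y, hy, rfl⟩
      exact hy
    · intro hx
      exact ⟨⟨x, leviIntegral_le_leviDetOne hx⟩, hx, rfl⟩
  exact hK.of_isClosed_subset isClosed_center hsub

end Def

end Literature.NumberTheory.Automorphic
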